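import Mathlib.MeasureTheory.Covering.OneDim
import Mathlib.MeasureTheory.Covering.Differentiation
import Mathlib.MeasureTheory.Integral.DominatedConvergence
import Mathlib.MeasureTheory.Integral.Average
import Mathlib.MeasureTheory.Function.StronglyMeasurable.Basic
import Literature.Probability.Process.ItoIntegralCore
import HarnessLib

/-!
# Construction of the Itô integral, III: simple processes are dense in the progressive `L²`

For a filtration `𝓕` on `(Ω, μ)` (finite measure, *no* usual conditions) and a progressively
measurable real integrand `H` with `E ∫₀ᵗ H² ds < ∞` for every `t`, there are bounded simple
processes `Hₙ` (`Literature.SimpleProcess m 𝓕`) with `E ∫₀ᵗ (Hₙ - H)² ds → 0` for every `t`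
(`Literature.Probability.Process.exists_tendsto_approxErr`). The three classical steps:

* **truncation** `H ↦ clamp k H` (`tendsto_sqErr_clamp`, dominated convergence);
* **averaging** of a bounded progressive `G`: `timeAvg G n (s) = (n+1) ∫_{(s - 1/(n+1))⁺}^{s} G_r dr`
  is adapted (a parametric integral over the past, `adapted_timeAvg`), has continuous paths and
  converges to `G` for a.e. time on every path (Lebesgue's differentiation theorem,
  `ae_tendsto_timeAvg_real`), hence in `L²(ds ⊗ μ)` (`tendsto_sqErr_timeAvg`);
* **dyadic sampling** of a bounded adapted process with continuous paths
  (`SimpleProcess.sample` of `ItoIntegralConstruction`, `tendsto_approxErr_sample`).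

Combined with `ItoIntegralCore` (u.c.p. limits of elementary integrals, martingale property of
`L²` limits) this gives the **existence of the Itô integral for square-integrable progressive
integrands** (last section):

* `Literature.Probability.Process.exists_isItoIntegral_of_sqErr_ne_top` — for a continuous square-integrable martingale
  `B` with `B_t² - t` a martingale on a probability space with a *raw* filtration `𝓕`, every
  progressive `H` with `E ∫₀ᵗ H² ds < ∞` for all `t` has an Itô integral `J = ∫ H dB` in the
  sense of `Literature.Probability.Process.IsItoIntegral`, which is moreover a square-integrable `𝓕`-martingale;
* `Literature.Probability.Process.exists_isItoIntegral_of_sq_integrable` — the case of the canonical Brownian motion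
  `Literature.Probability.Process.brownian`, its raw natural filtration and the pre-Wiener measure: the square-integrable
  case of the named fact `Literature.Probability.Process.exists_isItoIntegral` (`ItoCalculus.lean`), with the integral a
  true martingale (no localisation, hence no usual conditions, needed).

## References

* D. Revuz, M. Yor, *Continuous Martingales and Brownian Motion* (3rd ed., 1999), Ch. IV,
  Thm (2.2) (`K ↦ K·M` is an isometry from `L²(M)` into `H²₀`), Prop. (2.8) ("`ℰ` is dense in
  `L²(M)`") and the remark following it, Prop. (2.13); the averaging argument is that of
  I. Karatzas, S. Shreve, *Brownian Motion and Stochastic Calculus* (2nd ed., 1991),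
  Lemma 3.2.4, and of K. Itô, *Stochastic integral*, Proc. Imp. Acad. Tokyo 20 (1944).
-/

open MeasureTheory ProbabilityTheory Filter Finset
open scoped NNReal ENNReal Topology

namespace Literature.Probability.Process

variable {Ω : Type*} {m : MeasurableSpace Ω} {𝓕 : Filtration ℝ≥0 m} {μ : Measure Ω}

/-! ### The squared `L²(ds ⊗ μ)` distance between two processes -/

/-- The squared `L²(ds ⊗ μ)` distance on `[0, t]` between two real processes read in real time:
`∫⁻ ∫⁻_{[0,t]} (f(s) - g(s))² ds dμ` (so that `SimpleProcess.approxErr K H = sqErr K.toProcess H`).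
Revuz–Yor, *Continuous Martingales and Brownian Motion* (1999), Ch. IV, Def. (2.1). [folklore] -/
noncomputable def sqErr (f g : ℝ≥0 → Ω → ℝ) (μ : Measure Ω) (t : ℝ≥0) : ℝ≥0∞ :=
  ∫⁻ ω, (∫⁻ s in Set.Icc (0 : ℝ) t, ENNReal.ofReal ((f s.toNNReal ω - g s.toNNReal ω) ^ 2)) ∂μ

/-- `approxErr` is `sqErr` of the step process. [folklore] -/
theorem SimpleProcess.approxErr_eq_sqErr (K : SimpleProcess m 𝓕) (H : ℝ≥0 → Ω → ℝ)
    (μ : Measure Ω) (t : ℝ≥0) : K.approxErr H μ t = sqErr K.toProcess H μ t := rfl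

/-- `sqErr` is symmetric. [folklore] -/
theorem sqErr_comm (f g : ℝ≥0 → Ω → ℝ) (μ : Measure Ω) (t : ℝ≥0) :
    sqErr f g μ t = sqErr g f μ t := by
  unfold sqErr
  simp_rw [← neg_sub (g _ _) (f _ _), neg_sq]

/-- `sqErr` is monotone in the time horizon. [folklore] -/
theorem sqErr_mono (f g : ℝ≥0 → Ω → ℝ) (μ : Measure Ω) {t t' : ℝ≥0} (h : t ≤ t') :
    sqErr f g μ t ≤ sqErr f g μ t' :=
  lintegral_mono fun _ ↦ lintegral_mono_set (Set.Icc_subset_Icc le_rfl (NNReal.coe_le_coe.2 h))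

/-- The integrand of `sqErr` is jointly measurable for jointly measurable processes. [folklore] -/
theorem measurable_sqErr_integrand {f g : ℝ≥0 → Ω → ℝ}
    (hf : Measurable fun p : Ω × ℝ ↦ f p.2.toNNReal p.1)
    (hg : Measurable fun p : Ω × ℝ ↦ g p.2.toNNReal p.1) :
    Measurable fun p : Ω × ℝ ↦ ENNReal.ofReal ((f p.2.toNNReal p.1 - g p.2.toNNReal p.1) ^ 2) :=
  ((hf.sub hg).pow_const 2).ennreal_ofReal

/-- The inner integral of `sqErr` is measurable in `ω`. [folklore] -/
theorem measurable_lintegral_sqErr {f g : ℝ≥0 → Ω → ℝ}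
    (hf : Measurable fun p : Ω × ℝ ↦ f p.2.toNNReal p.1)
    (hg : Measurable fun p : Ω × ℝ ↦ g p.2.toNNReal p.1) (t : ℝ≥0) :
    Measurable fun ω ↦ ∫⁻ s in Set.Icc (0 : ℝ) t,
      ENNReal.ofReal ((f s.toNNReal ω - g s.toNNReal ω) ^ 2) :=
  (measurable_sqErr_integrand hf hg).lintegral_prod_right'

/-- `sqErr` as an integral over the product `μ ⊗ Leb|[0,t]` (Tonelli). [folklore] -/
theorem sqErr_eq_lintegral_prod {f g : ℝ≥0 → Ω → ℝ}
    (hf : Measurable fun p : Ω × ℝ ↦ f p.2.toNNReal p.1)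
    (hg : Measurable fun p : Ω × ℝ ↦ g p.2.toNNReal p.1) (t : ℝ≥0) :
    sqErr f g μ t = ∫⁻ p, ENNReal.ofReal ((f p.2.toNNReal p.1 - g p.2.toNNReal p.1) ^ 2)
      ∂(μ.prod (volume.restrict (Set.Icc (0 : ℝ) t))) := by
  rw [lintegral_prod _ (measurable_sqErr_integrand hf hg).aemeasurable]
  rfl

/-- The "triangle inequality" for `sqErr`: `sqErr f h ≤ 2 sqErr f g + 2 sqErr g h`. [folklore] -/
theorem sqErr_le_two_mul_add {f g h : ℝ≥0 → Ω → ℝ}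
    (hf : Measurable fun p : Ω × ℝ ↦ f p.2.toNNReal p.1)
    (hg : Measurable fun p : Ω × ℝ ↦ g p.2.toNNReal p.1)
    (hh : Measurable fun p : Ω × ℝ ↦ h p.2.toNNReal p.1) (t : ℝ≥0) :
    sqErr f h μ t ≤ 2 * sqErr f g μ t + 2 * sqErr g h μ t := by
  rw [sqErr_eq_lintegral_prod hf hh, sqErr_eq_lintegral_prod hf hg, sqErr_eq_lintegral_prod hg hh,
    ← lintegral_const_mul _ (measurable_sqErr_integrand hf hg),
    ← lintegral_const_mul _ (measurable_sqErr_integrand hg hh),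
    ← lintegral_add_left ((measurable_sqErr_integrand hf hg).const_mul 2)]
  refine lintegral_mono fun p ↦ ?_
  set a := f p.2.toNNReal p.1
  set b := g p.2.toNNReal p.1
  set c := h p.2.toNNReal p.1
  have hle : (a - c) ^ 2 ≤ 2 * (a - b) ^ 2 + 2 * (b - c) ^ 2 := by
    nlinarith [sq_nonneg (a - b - (b - c))]
  calc ENNReal.ofReal ((a - c) ^ 2) ≤ ENNReal.ofReal (2 * (a - b) ^ 2 + 2 * (b - c) ^ 2) :=
        ENNReal.ofReal_le_ofReal hle
    _ = 2 * ENNReal.ofReal ((a - b) ^ 2) + 2 * ENNReal.ofReal ((b - c) ^ 2) := by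
        rw [ENNReal.ofReal_add (by positivity) (by positivity), ENNReal.ofReal_mul zero_le_two,
          ENNReal.ofReal_mul zero_le_two, ENNReal.ofReal_ofNat]

/-! ### Joint measurability from progressive measurability -/

/-- A progressive real process, read in real time through `Real.toNNReal`, is jointly measurable
in `(ω, s)` (pointwise eventually constant limit of its restrictions to `Set.Iic n × Ω`).
Revuz–Yor, *Continuous Martingales and Brownian Motion* (1999), Ch. I, Def. (4.7). [folklore] -/
theorem measurable_toNNReal_of_isStronglyProgressive {U : ℝ≥0 → Ω → ℝ}
    (hU : IsStronglyProgressive 𝓕 U) : Measurable fun p : Ω × ℝ ↦ U p.2.toNNReal p.1 := by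
  have hn : ∀ n : ℕ, Measurable (fun p : Ω × ℝ ↦ U (min p.2.toNNReal (n : ℝ≥0)) p.1) := by
    intro n
    have h1 : Measurable[inferInstance, Subtype.instMeasurableSpace.prod (𝓕 n)]
        (fun p : Ω × ℝ ↦ ((⟨min p.2.toNNReal n, Set.mem_Iic.2 (min_le_right _ _)⟩, p.1) :
          Set.Iic (n : ℝ≥0) × Ω)) := by
      refine Measurable.prodMk ?_ ?_
      · exact ((measurable_real_toNNReal.comp measurable_snd).min measurable_const).subtype_mk
      · exact measurable_fst.mono le_rfl (𝓕.le n)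
    exact (hU n).measurable.comp h1
  refine measurable_of_tendsto_metrizable hn (tendsto_pi_nhds.2 fun p ↦ ?_)
  refine tendsto_const_nhds.congr' ?_
  filter_upwards [eventually_ge_atTop ⌈(p.2.toNNReal : ℝ≥0)⌉₊] with n hn'
  rw [min_eq_left ((Nat.le_ceil _).trans (by exact_mod_cast hn'))]

/-- Paths of a jointly measurable process are measurable (sections). [folklore] -/
theorem measurable_path_of_measurable_toNNReal {U : ℝ≥0 → Ω → ℝ}
    (h : Measurable fun p : Ω × ℝ ↦ U p.2.toNNReal p.1) (ω : Ω) :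
    Measurable fun r : ℝ ↦ U r.toNNReal ω :=
  h.comp (measurable_const.prodMk measurable_id)

/-- A continuous function of a progressive process is progressive. [folklore] -/
theorem IsStronglyProgressive.continuous_comp {U : ℝ≥0 → Ω → ℝ} (hU : IsStronglyProgressive 𝓕 U)
    {φ : ℝ → ℝ} (hφ : Continuous φ) : IsStronglyProgressive 𝓕 fun s ω ↦ φ (U s ω) :=
  fun i ↦ hφ.comp_stronglyMeasurable (hU i)

/-! ### Step 1: truncation -/

/-- Clamping moves a value by at most its size: `|clamp C x - x| ≤ |x|` (`C ≥ 0`). [folklore] -/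
theorem abs_clamp_sub_self_le {C : ℝ} (hC : 0 ≤ C) (x : ℝ) : |clamp C x - x| ≤ |x| := by
  unfold clamp
  rcases le_total x C with hxC | hCx
  · rw [min_eq_right hxC]
    rcases le_total (-C) x with h | h
    · rw [max_eq_right h, sub_self, abs_zero]; exact abs_nonneg x
    · rw [max_eq_left h, abs_of_nonneg (by linarith), abs_of_nonpos (by linarith)]
      linarith
  · rw [min_eq_left hCx, max_eq_right (by linarith), abs_of_nonpos (by linarith),
      abs_of_nonneg (by linarith)]
    linarith

/-- **Truncation step**: if `E ∫₀ᵗ H² < ∞` then `E ∫₀ᵗ (clamp k H - H)² → 0` as `k → ∞`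
(dominated convergence on `μ ⊗ Leb|[0,t]`, domination by `H²`).
Revuz–Yor, *Continuous Martingales and Brownian Motion* (1999), Ch. IV, Prop. (2.8). [folklore] -/
theorem tendsto_sqErr_clamp {H : ℝ≥0 → Ω → ℝ} (hHm : Measurable fun p : Ω × ℝ ↦ H p.2.toNNReal p.1)
    (t : ℝ≥0) (hfin : sqErr H 0 μ t ≠ ∞) :
    Tendsto (fun k : ℕ ↦ sqErr (fun s ω ↦ clamp k (H s ω)) H μ t) atTop (𝓝 0) := by
  have hcm : ∀ k : ℕ, Measurable fun p : Ω × ℝ ↦ clamp k (H p.2.toNNReal p.1) := fun k ↦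
    (continuous_clamp _).measurable.comp hHm
  have h0 : Measurable fun p : Ω × ℝ ↦ (0 : ℝ≥0 → Ω → ℝ) p.2.toNNReal p.1 := measurable_const
  have heq : ∀ k : ℕ, sqErr (fun s ω ↦ clamp k (H s ω)) H μ t =
      ∫⁻ p, ENNReal.ofReal ((clamp k (H p.2.toNNReal p.1) - H p.2.toNNReal p.1) ^ 2)
        ∂(μ.prod (volume.restrict (Set.Icc (0 : ℝ) t))) := fun k ↦
    sqErr_eq_lintegral_prod (f := fun s ω ↦ clamp k (H s ω)) (hcm k) hHm t
  simp_rw [heq]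
  rw [sqErr_eq_lintegral_prod hHm h0] at hfin
  simp only [Pi.zero_apply, sub_zero] at hfin
  have hlim := tendsto_lintegral_of_dominated_convergence
    (μ := μ.prod (volume.restrict (Set.Icc (0 : ℝ) t)))
    (F := fun (k : ℕ) (p : Ω × ℝ) ↦ ENNReal.ofReal ((clamp k (H p.2.toNNReal p.1) - H p.2.toNNReal p.1) ^ 2))
    (f := fun _ ↦ 0) (fun p ↦ ENNReal.ofReal (H p.2.toNNReal p.1 ^ 2))
    (fun k ↦ measurable_sqErr_integrand (f := fun s ω ↦ clamp k (H s ω)) (g := H) (hcm k) hHm)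
    (fun k ↦ ae_of_all _ fun p ↦ ?_) hfin
    (ae_of_all _ fun p ↦ ?_)
  · simp only [lintegral_zero] at hlim
    exact hlim
  · -- domination `(clamp k x - x)² ≤ x²`
    refine ENNReal.ofReal_le_ofReal ?_
    have h := abs_clamp_sub_self_le (Nat.cast_nonneg k) (H p.2.toNNReal p.1)
    rw [← sq_abs, ← sq_abs (H _ _)]
    exact pow_le_pow_left₀ (abs_nonneg _) h 2
  · -- eventually `clamp k x = x`
    refine tendsto_const_nhds.congr' ?_
    filter_upwards [eventually_ge_atTop ⌈|H p.2.toNNReal p.1|⌉₊] with k hk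
    rw [clamp_eq_self ((Nat.le_ceil _).trans (by exact_mod_cast hk)), sub_self]
    simp

/-! ### Step 2: averaging over the recent past -/

/-- **Backward time average** of a process over a window of length `1/(n+1)`:
`timeAvg G n s ω = (n+1) ∫_{(s - 1/(n+1)) ∨ 0}^{s} G_r(ω) dr` (interval integral in real time).
For a bounded progressive `G` this is an adapted process with continuous paths converging to
`G` at Lebesgue-a.e. time on every path — the device of Karatzas–Shreve, *Brownian Motion and
Stochastic Calculus* (1991), Lemma 3.2.4, for Revuz–Yor Ch. IV Prop. (2.8). [folklore] -/
noncomputable def timeAvg (G : ℝ≥0 → Ω → ℝ) (n : ℕ) : ℝ≥0 → Ω → ℝ :=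
  fun s ω ↦ ((n : ℝ) + 1) * ∫ r in max ((s : ℝ) - 1 / ((n : ℝ) + 1)) 0..(s : ℝ), G r.toNNReal ω

section TimeAvg

variable {G : ℝ≥0 → Ω → ℝ}

/-- The lower end `(s - h) ∨ 0` of the averaging window lies in `[0, s]` and within `h` of `s`.
[folklore] -/
theorem timeAvg_window (s : ℝ≥0) (n : ℕ) :
    0 ≤ max ((s : ℝ) - 1 / ((n : ℝ) + 1)) 0 ∧ max ((s : ℝ) - 1 / ((n : ℝ) + 1)) 0 ≤ s ∧
      (s : ℝ) - max ((s : ℝ) - 1 / ((n : ℝ) + 1)) 0 ≤ 1 / ((n : ℝ) + 1) := by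
  refine ⟨le_max_right _ _, max_le (by simp; positivity) s.2, ?_⟩
  have : (s : ℝ) - 1 / ((n : ℝ) + 1) ≤ max ((s : ℝ) - 1 / ((n : ℝ) + 1)) 0 := le_max_left _ _
  linarith

/-- **Parametric integrals over the past are adapted**: for a progressive `G` and real times
`0 ≤ a ≤ b ≤ i`, `ω ↦ ∫ₐᵇ G_r(ω) dr` is `𝓕 i`-measurable (Fubini measurability on `Ω × ℝ` with
the σ-algebra `𝓕 i ⊗ 𝓑`).
Revuz–Yor, *Continuous Martingales and Brownian Motion* (1999), Ch. I, Prop. (4.8). [folklore] -/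
theorem stronglyMeasurable_intervalIntegral_of_isStronglyProgressive
    (hG : IsStronglyProgressive 𝓕 G) {a b : ℝ} {i : ℝ≥0} (hab : a ≤ b) (hbi : b ≤ i) :
    StronglyMeasurable[𝓕 i] fun ω ↦ ∫ r in a..b, G r.toNNReal ω := by
  letI mΩ : MeasurableSpace Ω := 𝓕 i
  have hGi : Measurable (fun p : Set.Iic i × Ω ↦ G p.1 p.2) := (hG i).measurable
  have hF : Measurable (fun q : Ω × ℝ ↦ G (min q.2.toNNReal i) q.1) := by
    have h1 : Measurable (fun q : Ω × ℝ ↦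
        ((⟨min q.2.toNNReal i, Set.mem_Iic.2 (min_le_right _ _)⟩, q.1) : Set.Iic i × Ω)) :=
      ((measurable_real_toNNReal.comp measurable_snd).min measurable_const).subtype_mk.prodMk
        measurable_fst
    exact hGi.comp h1
  have hint := StronglyMeasurable.integral_prod_right'
    (ν := (volume : Measure ℝ).restrict (Set.Ioc a b)) hF.stronglyMeasurable
  have heq : (fun ω ↦ ∫ r in a..b, G r.toNNReal ω) =
      fun ω ↦ ∫ r in Set.Ioc a b, G (min r.toNNReal i) ω := by
    funext ω
    rw [intervalIntegral.integral_of_le hab]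
    refine setIntegral_congr_fun measurableSet_Ioc fun r hr ↦ ?_
    rw [min_eq_left]
    exact Real.toNNReal_le_iff_le_coe.2 (hr.2.trans hbi)
  rw [heq]
  exact hint

/-- **The time average of a progressive process is adapted.**
Karatzas–Shreve, *Brownian Motion and Stochastic Calculus* (1991), Lemma 3.2.4. [folklore] -/
theorem stronglyAdapted_timeAvg (hG : IsStronglyProgressive 𝓕 G) (n : ℕ) :
    StronglyAdapted 𝓕 (timeAvg G n) := by
  intro s
  obtain ⟨h0, hs, -⟩ := timeAvg_window s n
  exact (stronglyMeasurable_const.mul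
    (stronglyMeasurable_intervalIntegral_of_isStronglyProgressive hG hs le_rfl))

/-- The time average of a progressive process is adapted. [folklore] -/
theorem adapted_timeAvg (hG : IsStronglyProgressive 𝓕 G) (n : ℕ) : Adapted 𝓕 (timeAvg G n) :=
  (stronglyAdapted_timeAvg hG n).adapted

/-- Interval integrability of a bounded measurable path. [folklore] -/
theorem intervalIntegrable_of_bdd {g : ℝ → ℝ} (hg : Measurable g) {C : ℝ} (hC : ∀ r, |g r| ≤ C)
    (a b : ℝ) : IntervalIntegrable g volume a b := by
  refine (intervalIntegrable_const (c := C)).mono_fun hg.aestronglyMeasurable ?_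
  exact ae_of_all _ fun r ↦ by simpa [Real.norm_eq_abs] using (hC r).trans (le_abs_self C)

/-- **The time average of a bounded process has continuous paths** (on every path whose
real-time reading is measurable). [folklore] -/
theorem continuous_timeAvg {ω : Ω} (hg : Measurable fun r : ℝ ↦ G r.toNNReal ω) {C : ℝ}
    (hC : ∀ s, |G s ω| ≤ C) (n : ℕ) : Continuous fun s ↦ timeAvg G n s ω := by
  have hii : ∀ a b : ℝ, IntervalIntegrable (fun r : ℝ ↦ G r.toNNReal ω) volume a b :=
    intervalIntegrable_of_bdd hg (fun r ↦ hC _)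
  have hP : Continuous fun x : ℝ ↦ ∫ r in (0 : ℝ)..x, G r.toNNReal ω :=
    intervalIntegral.continuous_primitive hii 0
  have heq : (fun s : ℝ≥0 ↦ timeAvg G n s ω) = fun s : ℝ≥0 ↦ ((n : ℝ) + 1) *
      ((∫ r in (0 : ℝ)..(s : ℝ), G r.toNNReal ω) -
        ∫ r in (0 : ℝ)..max ((s : ℝ) - 1 / ((n : ℝ) + 1)) 0, G r.toNNReal ω) := by
    funext s
    rw [timeAvg, intervalIntegral.integral_interval_sub_left (hii _ _) (hii _ _)]
  rw [heq]
  refine continuous_const.mul ((hP.comp NNReal.continuous_coe).sub (hP.comp ?_))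
  exact (NNReal.continuous_coe.sub continuous_const).max continuous_const

/-- **The time average of a bounded process is bounded by the same constant.** [folklore] -/
theorem abs_timeAvg_le {C : ℝ} (hC : ∀ s ω, |G s ω| ≤ C) (n : ℕ) (s : ℝ≥0) (ω : Ω) :
    |timeAvg G n s ω| ≤ C := by
  obtain ⟨h0, hs, hlen⟩ := timeAvg_window s n
  have hn : (0 : ℝ) < (n : ℝ) + 1 := by positivity
  rw [timeAvg, abs_mul, abs_of_pos hn]
  have h1 := intervalIntegral.norm_integral_le_of_norm_le_const (a := max ((s : ℝ) - 1 / ((n : ℝ) + 1)) 0)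
    (b := (s : ℝ)) (C := C) (f := fun r : ℝ ↦ G r.toNNReal ω) fun r _ ↦ by
      simpa [Real.norm_eq_abs] using hC r.toNNReal ω
  rw [Real.norm_eq_abs, abs_of_nonneg (sub_nonneg.2 hs)] at h1
  have hC0 : 0 ≤ C := (abs_nonneg _).trans (hC 0 ω)
  calc ((n : ℝ) + 1) * |∫ r in max ((s : ℝ) - 1 / ((n : ℝ) + 1)) 0..(s : ℝ), G r.toNNReal ω|
      ≤ ((n : ℝ) + 1) * (C * (1 / ((n : ℝ) + 1))) := by
        gcongr
        exact h1.trans (mul_le_mul_of_nonneg_left hlen hC0)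
    _ = C := by field_simp

/-- **Lebesgue's differentiation theorem, backward windows**: for a bounded measurable
`g : ℝ → ℝ`, for a.e. `x > 0`, `(n+1) ∫_{(x - 1/(n+1)) ∨ 0}^{x} g → g(x)`
(Mathlib's `VitaliFamily.ae_tendsto_average` with the one-sided intervals
`Real.tendsto_Icc_vitaliFamily_left`).
H. Lebesgue (1904); Mathlib `VitaliFamily.ae_tendsto_average`. [folklore] -/
theorem ae_tendsto_timeAvg_real {g : ℝ → ℝ} (hg : Measurable g) {C : ℝ} (hC : ∀ r, |g r| ≤ C) :
    ∀ᵐ x ∂(volume : Measure ℝ), 0 < x →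
      Tendsto (fun n : ℕ ↦ ((n : ℝ) + 1) * ∫ r in max (x - 1 / ((n : ℝ) + 1)) 0..x, g r)
        atTop (𝓝 (g x)) := by
  have hli : LocallyIntegrable g volume := by
    refine (locallyIntegrable_const C).mono hg.aestronglyMeasurable ?_
    exact ae_of_all _ fun r ↦ by simpa [Real.norm_eq_abs] using (hC r).trans (le_abs_self C)
  have h := (IsUnifLocDoublingMeasure.vitaliFamily (volume : Measure ℝ) 1).ae_tendsto_average hli
  filter_upwards [h] with x hx hxpos
  have h2 := hx.comp (Real.tendsto_Icc_vitaliFamily_left x)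
  -- the window ends `y n = x - 1/(n+1) → x⁻`
  have hy : Tendsto (fun n : ℕ ↦ x - 1 / ((n : ℝ) + 1)) atTop (𝓝[<] x) := by
    rw [tendsto_nhdsWithin_iff]
    refine ⟨?_, Eventually.of_forall fun n ↦ ?_⟩
    · simpa using (tendsto_const_nhds (x := x)).sub (tendsto_one_div_add_atTop_nhds_zero_nat (𝕜 := ℝ))
    · simp only [Set.mem_Iio, sub_lt_self_iff]; positivity
  have h3 := h2.comp hy
  -- eventually the window is `[x - 1/(n+1), x] ⊆ (0, x]` and the average is the normalised integral
  refine h3.congr' ?_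
  have hev : ∀ᶠ n : ℕ in atTop, 1 / ((n : ℝ) + 1) < x := by
    have := tendsto_one_div_add_atTop_nhds_zero_nat (𝕜 := ℝ)
    exact this.eventually (gt_mem_nhds hxpos)
  filter_upwards [hev] with n hn
  have hnpos : (0 : ℝ) < 1 / ((n : ℝ) + 1) := by positivity
  have hmax : max (x - 1 / ((n : ℝ) + 1)) 0 = x - 1 / ((n : ℝ) + 1) := max_eq_left (by linarith)
  simp only [Function.comp_apply]
  rw [hmax, setAverage_eq, Real.volume_real_Icc_of_le (by linarith), integral_Icc_eq_integral_Ioc,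
    ← intervalIntegral.integral_of_le (by linarith), smul_eq_mul]
  congr 1
  rw [show x - (x - 1 / ((n : ℝ) + 1)) = 1 / ((n : ℝ) + 1) by ring, one_div, inv_inv]

/-- **Pathwise convergence of the time averages** of a bounded process with measurable path:
`∫⁻_{[0,t]} (timeAvg G n - G)² ds → 0` for every such path (Lebesgue differentiation and
dominated convergence on `[0, t]`).
Karatzas–Shreve, *Brownian Motion and Stochastic Calculus* (1991), Lemma 3.2.4. [folklore] -/
theorem tendsto_lintegral_timeAvg_sub_sq {ω : Ω} (hg : Measurable fun r : ℝ ↦ G r.toNNReal ω)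
    {C : ℝ} (hC : ∀ s ω, |G s ω| ≤ C) (t : ℝ≥0) :
    Tendsto (fun n ↦ ∫⁻ s in Set.Icc (0 : ℝ) t,
      ENNReal.ofReal ((timeAvg G n s.toNNReal ω - G s.toNNReal ω) ^ 2)) atTop (𝓝 0) := by
  have hcont : ∀ n, Continuous fun s ↦ timeAvg G n s ω := fun n ↦
    continuous_timeAvg hg (fun s ↦ hC s ω) n
  have hmeas : ∀ n, Measurable fun s : ℝ ↦
      ENNReal.ofReal ((timeAvg G n s.toNNReal ω - G s.toNNReal ω) ^ 2) := fun n ↦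
    ((((hcont n).measurable.comp measurable_real_toNNReal).sub hg).pow_const 2).ennreal_ofReal
  have hae := ae_tendsto_timeAvg_real hg (C := C) (fun r ↦ hC _ _)
  have hlim := tendsto_lintegral_of_dominated_convergence
    (μ := (volume : Measure ℝ).restrict (Set.Icc (0 : ℝ) t))
    (F := fun n (s : ℝ) ↦ ENNReal.ofReal ((timeAvg G n s.toNNReal ω - G s.toNNReal ω) ^ 2))
    (f := fun _ ↦ 0) (fun _ ↦ ENNReal.ofReal ((2 * C) ^ 2)) hmeas
    (fun n ↦ ae_of_all _ fun s ↦ ?_) (by simp [ENNReal.mul_eq_top]) ?_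
  · simp only [lintegral_zero] at hlim
    exact hlim
  · -- domination by `(2C)²`
    refine ENNReal.ofReal_le_ofReal ?_
    have h1 := abs_timeAvg_le hC n s.toNNReal ω
    have h2 := hC s.toNNReal ω
    have h3 : |timeAvg G n s.toNNReal ω - G s.toNNReal ω| ≤ 2 * C :=
      (abs_sub _ _).trans (by linarith)
    rw [← sq_abs]
    have hC0 : 0 ≤ C := (abs_nonneg _).trans h2
    exact pow_le_pow_left₀ (abs_nonneg _) h3 2
  · -- a.e. convergence on `[0, t]`: at every `x > 0` of the differentiation set
    rw [ae_restrict_iff' measurableSet_Icc]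
    have hx0 : ∀ᵐ x ∂(volume : Measure ℝ), x ≠ 0 := by
      simp [ae_iff]
    filter_upwards [hae, hx0] with x hx hxne hxmem
    have hxpos : 0 < x := lt_of_le_of_ne hxmem.1 (Ne.symm hxne)
    have h := hx hxpos
    have hcoe : ((x.toNNReal : ℝ≥0) : ℝ) = x := Real.coe_toNNReal _ hxpos.le
    have heq : ∀ n, timeAvg G n x.toNNReal ω =
        ((n : ℝ) + 1) * ∫ r in max (x - 1 / ((n : ℝ) + 1)) 0..x, G r.toNNReal ω := by
      intro n; rw [timeAvg, hcoe]
    have h5 : Tendsto (fun n : ℕ ↦ timeAvg G n x.toNNReal ω) atTop (𝓝 (G x.toNNReal ω)) := by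
      simp only [heq]; exact h
    have h6 : Tendsto (fun n : ℕ ↦ (timeAvg G n x.toNNReal ω - G x.toNNReal ω) ^ 2) atTop (𝓝 0) := by
      simpa using (h5.sub_const (G x.toNNReal ω)).pow 2
    have h7 := (ENNReal.continuous_ofReal.tendsto 0).comp h6
    rw [ENNReal.ofReal_zero] at h7
    exact h7

/-- Joint measurability of the time averages of a bounded progressive process (adapted with
continuous paths). [folklore] -/
theorem measurable_timeAvg_toNNReal (hG : IsStronglyProgressive 𝓕 G) {C : ℝ}
    (hC : ∀ s ω, |G s ω| ≤ C) (n : ℕ) :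
    Measurable fun p : Ω × ℝ ↦ timeAvg G n p.2.toNNReal p.1 := by
  have hGm := measurable_toNNReal_of_isStronglyProgressive hG
  have h1 : Measurable (Function.uncurry (timeAvg G n)) :=
    measurable_uncurry_of_continuous_of_measurable
      (fun ω ↦ continuous_timeAvg (measurable_path_of_measurable_toNNReal hGm ω) (fun s ↦ hC s ω) n)
      (fun s ↦ ((stronglyAdapted_timeAvg hG n s).mono (𝓕.le s)).measurable)
  have h2 : Measurable fun p : Ω × ℝ ↦ (p.2.toNNReal, p.1) :=
    (measurable_real_toNNReal.comp measurable_snd).prodMk measurable_fst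
  -- rewrite syntactically (a definitional `exact` would unfold `timeAvg`)
  have h3 : (fun p : Ω × ℝ ↦ timeAvg G n p.2.toNNReal p.1) =
      Function.uncurry (timeAvg G n) ∘ fun p : Ω × ℝ ↦ (p.2.toNNReal, p.1) := by
    funext p
    simp only [Function.comp_apply, Function.uncurry_apply_pair]
  rw [h3]
  exact h1.comp h2

/-- **Averaging step**: for a bounded progressive `G`, `E ∫₀ᵗ (timeAvg G n - G)² → 0`
(pathwise convergence and dominated convergence in `ω`, finite measure).
Karatzas–Shreve, *Brownian Motion and Stochastic Calculus* (1991), Lemma 3.2.4; Revuz–Yor,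
Ch. IV, Prop. (2.8). [folklore] -/
theorem tendsto_sqErr_timeAvg [IsFiniteMeasure μ] (hG : IsStronglyProgressive 𝓕 G) {C : ℝ}
    (hC : ∀ s ω, |G s ω| ≤ C) (t : ℝ≥0) :
    Tendsto (fun n ↦ sqErr (timeAvg G n) G μ t) atTop (𝓝 0) := by
  have hGm := measurable_toNNReal_of_isStronglyProgressive hG
  have hAm := fun n ↦ measurable_timeAvg_toNNReal hG hC n
  unfold sqErr
  have hlim := tendsto_lintegral_of_dominated_convergence (μ := μ)
    (F := fun n ω ↦ ∫⁻ s in Set.Icc (0 : ℝ) t,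
      ENNReal.ofReal ((timeAvg G n s.toNNReal ω - G s.toNNReal ω) ^ 2))
    (f := fun _ ↦ 0) (fun _ ↦ ENNReal.ofReal ((2 * C) ^ 2) * volume (Set.Icc (0 : ℝ) t))
    (fun n ↦ measurable_lintegral_sqErr (hAm n) hGm t) (fun n ↦ ae_of_all _ fun ω ↦ ?_)
    (by simp [Real.volume_Icc, ENNReal.mul_eq_top]) (ae_of_all _ fun ω ↦ ?_)
  · simp only [lintegral_zero] at hlim
    exact hlim
  · -- domination
    calc ∫⁻ s in Set.Icc (0 : ℝ) t, ENNReal.ofReal ((timeAvg G n s.toNNReal ω - G s.toNNReal ω) ^ 2)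
        ≤ ∫⁻ _ in Set.Icc (0 : ℝ) t, ENNReal.ofReal ((2 * C) ^ 2) := by
          refine lintegral_mono fun s ↦ ENNReal.ofReal_le_ofReal ?_
          have h1 := abs_timeAvg_le hC n s.toNNReal ω
          have h2 := hC s.toNNReal ω
          have h3 : |timeAvg G n s.toNNReal ω - G s.toNNReal ω| ≤ 2 * C :=
            (abs_sub _ _).trans (by linarith)
          rw [← sq_abs]
          exact pow_le_pow_left₀ (abs_nonneg _) h3 2
      _ = ENNReal.ofReal ((2 * C) ^ 2) * volume (Set.Icc (0 : ℝ) t) := by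
          rw [setLIntegral_const]
  · exact tendsto_lintegral_timeAvg_sub_sq (measurable_path_of_measurable_toNNReal hGm ω) hC t

end TimeAvg

/-! ### Step 3: dyadic sampling of a bounded adapted process with continuous paths -/

section Sample

variable {σ : ℝ≥0 → Ω → ℝ} (hσ : Adapted 𝓕 σ)

/-- The sampled process of a process bounded by `C ≥ 0` is bounded by `C`. [folklore] -/
theorem SimpleProcess.abs_toProcess_sample_le' {C : ℝ} (hC0 : 0 ≤ C) (hC : ∀ s ω, |σ s ω| ≤ C)
    (n : ℕ) (s : ℝ≥0) (ω : Ω) : |(SimpleProcess.sample σ hσ n).toProcess s ω| ≤ C := by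
  have hval : ∀ i ω, |(SimpleProcess.sample σ hσ n).value i ω| ≤ C := fun i ω ↦ by
    rw [SimpleProcess.sample_value]
    exact (abs_clamp_le_abs (Nat.cast_nonneg n) _).trans (hC _ _)
  have h := (SimpleProcess.sample σ hσ n).abs_toProcess_le hval s ω
  rwa [max_eq_left hC0] at h

/-- **Sampling step**: for a bounded adapted `σ` with continuous paths and jointly measurable,
`E ∫₀ᵗ (sample σ n - σ)² → 0` (pathwise `tendsto_lintegral_sample_sub_sq` and dominated
convergence in `ω`).
Revuz–Yor, *Continuous Martingales and Brownian Motion* (1999), Ch. IV, Prop. (2.8) and proof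
of Prop. (2.13). [folklore] -/
theorem tendsto_approxErr_sample [IsFiniteMeasure μ] (hσc : ∀ ω, Continuous (σ · ω))
    (hσm : Measurable fun p : Ω × ℝ ↦ σ p.2.toNNReal p.1) {C : ℝ} (hC : ∀ s ω, |σ s ω| ≤ C)
    (t : ℝ≥0) :
    Tendsto (fun n ↦ (SimpleProcess.sample σ hσ n).approxErr σ μ t) atTop (𝓝 0) := by
  have hSm : ∀ n, Measurable fun p : Ω × ℝ ↦
      (SimpleProcess.sample σ hσ n).toProcess p.2.toNNReal p.1 := fun n ↦
    (SimpleProcess.sample σ hσ n).measurable_toProcess_prod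
  simp_rw [SimpleProcess.approxErr_eq_sqErr]
  unfold sqErr
  have hlim := tendsto_lintegral_of_dominated_convergence (μ := μ)
    (F := fun n ω ↦ ∫⁻ s in Set.Icc (0 : ℝ) t, ENNReal.ofReal
      (((SimpleProcess.sample σ hσ n).toProcess s.toNNReal ω - σ s.toNNReal ω) ^ 2))
    (f := fun _ ↦ 0) (fun _ ↦ ENNReal.ofReal ((2 * C) ^ 2) * volume (Set.Icc (0 : ℝ) t))
    (fun n ↦ measurable_lintegral_sqErr (hSm n) hσm t) (fun n ↦ ae_of_all _ fun ω ↦ ?_)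
    (by simp [Real.volume_Icc, ENNReal.mul_eq_top]) (ae_of_all _ fun ω ↦ ?_)
  · simp only [lintegral_zero] at hlim
    exact hlim
  · -- domination by `(2C)² t`
    have hC0 : 0 ≤ C := (abs_nonneg _).trans (hC 0 ω)
    calc ∫⁻ s in Set.Icc (0 : ℝ) t, ENNReal.ofReal
          (((SimpleProcess.sample σ hσ n).toProcess s.toNNReal ω - σ s.toNNReal ω) ^ 2)
        ≤ ∫⁻ _ in Set.Icc (0 : ℝ) t, ENNReal.ofReal ((2 * C) ^ 2) := by
          refine lintegral_mono fun s ↦ ENNReal.ofReal_le_ofReal ?_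
          have h1 := SimpleProcess.abs_toProcess_sample_le' hσ hC0 hC n s.toNNReal ω
          have h2 := hC s.toNNReal ω
          have h3 : |(SimpleProcess.sample σ hσ n).toProcess s.toNNReal ω - σ s.toNNReal ω| ≤
              2 * C := (abs_sub _ _).trans (by linarith)
          rw [← sq_abs]
          exact pow_le_pow_left₀ (abs_nonneg _) h3 2
      _ = ENNReal.ofReal ((2 * C) ^ 2) * volume (Set.Icc (0 : ℝ) t) := by
          rw [setLIntegral_const]
  · exact SimpleProcess.tendsto_lintegral_sample_sub_sq σ hσ (hσc ω) t

end Sample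

/-! ### Assembly: density of simple processes -/

section Density

variable [IsFiniteMeasure μ] {H : ℝ≥0 → Ω → ℝ}

/-- **Simple processes are dense in the progressive `L²(ds ⊗ μ)`** (ε-form): for a progressive
`H` with `E ∫₀ᵀ H² < ∞` and `ε > 0` there is a bounded simple process `S` with
`E ∫₀ᵀ (S - H)² ≤ ε` (truncate, average, sample; the three errors are combined with
`sqErr_le_two_mul_add`). No usual conditions on `𝓕` are needed.
Revuz–Yor, *Continuous Martingales and Brownian Motion* (1999), Ch. IV, Prop. (2.8);
Karatzas–Shreve (1991), Lemma 3.2.4 and Prop. 3.2.6. [cite: RevuzYor1999, Ch. IV Prop. (2.8)] -/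
theorem exists_simpleProcess_approxErr_le (hH : IsStronglyProgressive 𝓕 H) (T : ℝ≥0)
    (hfin : sqErr H 0 μ T ≠ ∞) {ε : ℝ≥0∞} (hε : 0 < ε) :
    ∃ S : SimpleProcess m 𝓕, S.approxErr H μ T ≤ ε := by
  have hHm := measurable_toNNReal_of_isStronglyProgressive hH
  -- the error budget `δ = ε / 10`
  set δ : ℝ≥0∞ := ε / 10 with hδ
  have hδpos : 0 < δ := ENNReal.div_pos hε.ne' (by norm_num)
  have hδε : 2 * δ + 2 * (2 * δ + 2 * δ) = ε := by
    rw [hδ]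
    have : 2 * (ε / 10) + 2 * (2 * (ε / 10) + 2 * (ε / 10)) = 10 * (ε / 10) := by ring
    rw [this, ENNReal.mul_div_cancel (by norm_num) (by norm_num)]
  -- Step 1: truncation level `k`
  obtain ⟨k, hk⟩ := (eventually_atTop.1
    ((ENNReal.tendsto_nhds_zero.1 (tendsto_sqErr_clamp hHm T hfin)) δ hδpos))
  have hk' := hk k le_rfl
  set G : ℝ≥0 → Ω → ℝ := fun s ω ↦ clamp k (H s ω) with hG
  have hGp : IsStronglyProgressive 𝓕 G :=
    IsStronglyProgressive.continuous_comp hH (continuous_clamp _)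
  have hGbdd : ∀ s ω, |G s ω| ≤ k := fun s ω ↦
    (abs_clamp_le (k : ℝ) (H s ω)).trans_eq (abs_of_nonneg (Nat.cast_nonneg (α := ℝ) k))
  have hGm := measurable_toNNReal_of_isStronglyProgressive hGp
  -- Step 2: averaging window `1/(n+1)`
  obtain ⟨n, hn⟩ := (eventually_atTop.1
    ((ENNReal.tendsto_nhds_zero.1 (tendsto_sqErr_timeAvg (μ := μ) hGp hGbdd T)) δ hδpos))
  have hn' := hn n le_rfl
  set A : ℝ≥0 → Ω → ℝ := timeAvg G n with hA
  have hAa : Adapted 𝓕 A := adapted_timeAvg hGp n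
  have hAm : Measurable fun p : Ω × ℝ ↦ A p.2.toNNReal p.1 := measurable_timeAvg_toNNReal hGp hGbdd n
  have hAc : ∀ ω, Continuous (A · ω) := fun ω ↦
    continuous_timeAvg (measurable_path_of_measurable_toNNReal hGm ω) (fun s ↦ hGbdd s ω) n
  have hAbdd : ∀ s ω, |A s ω| ≤ k := fun s ω ↦ abs_timeAvg_le hGbdd n s ω
  -- Step 3: sampling mesh `2⁻ʲ`
  obtain ⟨j, hj⟩ := (eventually_atTop.1
    ((ENNReal.tendsto_nhds_zero.1 (tendsto_approxErr_sample (μ := μ) hAa hAc hAm hAbdd T)) δ hδpos))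
  have hj' := hj j le_rfl
  refine ⟨SimpleProcess.sample A hAa j, ?_⟩
  -- combine
  have hSm : Measurable fun p : Ω × ℝ ↦ (SimpleProcess.sample A hAa j).toProcess p.2.toNNReal p.1 :=
    (SimpleProcess.sample A hAa j).measurable_toProcess_prod
  rw [SimpleProcess.approxErr_eq_sqErr] at hj' ⊢
  calc sqErr (SimpleProcess.sample A hAa j).toProcess H μ T
      ≤ 2 * sqErr (SimpleProcess.sample A hAa j).toProcess A μ T + 2 * sqErr A H μ T :=
        sqErr_le_two_mul_add hSm hAm hHm T
    _ ≤ 2 * sqErr (SimpleProcess.sample A hAa j).toProcess A μ T +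
          2 * (2 * sqErr A G μ T + 2 * sqErr G H μ T) := by
        gcongr
        exact sqErr_le_two_mul_add hAm hGm hHm T
    _ ≤ 2 * δ + 2 * (2 * δ + 2 * δ) := by gcongr
    _ = ε := hδε

/-- **Simple processes are dense in the progressive `L²(ds ⊗ μ)`** (sequence form): for a
progressive `H` with `E ∫₀ᵗ H² < ∞` for every `t` there are bounded simple processes `Hₙ` with
`E ∫₀ᵗ (Hₙ - H)² → 0` for every `t`; in particular `Hₙ` is an approximating sequence of `H` in
the sense of `SimpleProcess.IsApproxSeq`.
Revuz–Yor, *Continuous Martingales and Brownian Motion* (1999), Ch. IV, Prop. (2.8).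
[cite: RevuzYor1999, Ch. IV Prop. (2.8)] -/
theorem exists_tendsto_approxErr (hH : IsStronglyProgressive 𝓕 H)
    (hfin : ∀ t : ℝ≥0, sqErr H 0 μ t ≠ ∞) :
    ∃ Hn : ℕ → SimpleProcess m 𝓕, (∀ t : ℝ≥0, Tendsto (fun n ↦ (Hn n).approxErr H μ t) atTop (𝓝 0)) ∧
      SimpleProcess.IsApproxSeq Hn H μ := by
  have hε : ∀ n : ℕ, (0 : ℝ≥0∞) < ((n : ℝ≥0∞) + 1)⁻¹ := fun n ↦
    ENNReal.inv_pos.2 (by simp)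
  choose S hS using fun n : ℕ ↦ exists_simpleProcess_approxErr_le (μ := μ) hH (n : ℝ≥0) (hfin n) (hε n)
  have hlim : ∀ t : ℝ≥0, Tendsto (fun n ↦ (S n).approxErr H μ t) atTop (𝓝 0) := by
    intro t
    have h0 : Tendsto (fun n : ℕ ↦ ((n : ℝ≥0∞) + 1)⁻¹) atTop (𝓝 0) := by
      have h := ENNReal.tendsto_inv_nat_nhds_zero.comp (tendsto_add_atTop_nat 1)
      refine h.congr fun n ↦ ?_
      simp [Function.comp_apply, Nat.cast_succ]
    refine tendsto_of_tendsto_of_tendsto_of_le_of_le' tendsto_const_nhds h0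
      (Eventually.of_forall fun n ↦ bot_le) ?_
    filter_upwards [eventually_ge_atTop ⌈(t : ℝ)⌉₊] with n hn
    have hnt : t ≤ (n : ℝ≥0) := by
      rw [← NNReal.coe_le_coe]; push_cast
      exact (Nat.le_ceil _).trans (by exact_mod_cast hn)
    exact (sqErr_mono _ _ _ hnt).trans (hS n)
  exact ⟨S, hlim, SimpleProcess.isApproxSeq_of_tendsto_approxErr
    (measurable_toNNReal_of_isStronglyProgressive hH) hlim⟩

end Density

end Literature.Probability.Process

namespace Literature.Probability.Process

/-! ### Existence of the Itô integral for square-integrable progressive integrands -/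

section Existence

variable {Ω : Type*} {m : MeasurableSpace Ω} {𝓕 : Filtration ℝ≥0 m} {μ : Measure Ω}

/-- **Existence of the Itô integral of a square-integrable progressive integrand** against a
continuous square-integrable martingale `B` with `⟨B⟩_t = t`, for a raw filtration on a
probability space: there is `J` with `IsItoIntegral H B J 𝓕 μ`; `J` is a square-integrable
`𝓕`-martingale, strongly adapted, and `(Hₙ·B)_t → J_t` in `L²` for some simple `Hₙ → H` in
`L²(ds ⊗ μ)` on every `[0, t]`.
Revuz–Yor, *Continuous Martingales and Brownian Motion* (1999), Ch. IV, Thm (2.2), Prop. (2.8)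
and Prop. (2.13). [cite: RevuzYor1999, Ch. IV Thm (2.2)] -/
theorem exists_isItoIntegral_of_sqErr_ne_top [IsProbabilityMeasure μ] {B : ℝ≥0 → Ω → ℝ}
    (hB : Martingale B 𝓕 μ) (hBsq : Martingale (fun t ω ↦ B t ω ^ 2 - (t : ℝ)) 𝓕 μ)
    (hB2 : ∀ t, MemLp (B t) 2 μ) (hBc : ∀ ω, Continuous (B · ω)) {H : ℝ≥0 → Ω → ℝ}
    (hH : IsStronglyProgressive 𝓕 H) (hfin : ∀ t : ℝ≥0, sqErr H 0 μ t ≠ ∞) :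
    ∃ J : ℝ≥0 → Ω → ℝ, IsItoIntegral H B J 𝓕 μ ∧ Martingale J 𝓕 μ ∧ (∀ t, MemLp (J t) 2 μ) ∧
      ∃ Hn : ℕ → SimpleProcess m 𝓕, (∀ t : ℝ≥0, Tendsto (fun n ↦ (Hn n).approxErr H μ t) atTop (𝓝 0)) ∧
        ∀ t : ℝ≥0, Tendsto (fun n ↦ ∫⁻ ω, ENNReal.ofReal (((Hn n).integral B t ω - J t ω) ^ 2) ∂μ)
          atTop (𝓝 0) := by
  have hHm := measurable_toNNReal_of_isStronglyProgressive hH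
  obtain ⟨Hn, hL2, hHn⟩ := exists_tendsto_approxErr (μ := μ) hH hfin
  obtain ⟨J, hJa, hJc, hJ0, hJucp, φ, hφ, hunif⟩ := exists_ucpLimit_integral hHn
    (measurable_path_of_measurable_toNNReal hHm) hB hBsq hB2 hBc
  have hae : ∀ᵐ ω ∂μ, ∀ t : ℝ≥0, Tendsto (fun k ↦ (Hn (φ k)).integral B t ω) atTop (𝓝 (J t ω)) :=
    hunif.mono fun ω hω t ↦ (hω t).tendsto_at (Set.mem_Iic.2 le_rfl)
  obtain ⟨hJM, hJ2⟩ := martingale_limit_of_tendsto_approxErr hHm hB hBsq hB2 hJa hφ hae hL2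
  refine ⟨J, ⟨hJ0, hJc, hJM.isLocalMartingale, ⟨Hn, hHn⟩, hJucp⟩, hJM, hJ2, Hn, hL2, fun t ↦ ?_⟩
  exact tendsto_lintegral_integral_sub_limit_sq hHm hB hBsq hB2 hφ t
    (hae.mono fun ω hω ↦ hω t) (hL2 t)

/-- **Existence of the Itô integral against the canonical Brownian motion for square-integrable
progressive integrands**: if `H` is progressively measurable for the raw Brownian filtration and
`E ∫₀ᵗ H² ds < ∞` for every `t`, then `H` has an Itô integral
(`IsItoIntegral H brownian J brownianFiltration preWienerMeasure`) which is a square-integrable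
martingale for the raw filtration. This is the `L²` case of the named fact
`Literature.Probability.Process.exists_isItoIntegral` (which asks only `∫₀ᵗ H² < ∞` a.s.); the integral being a true
martingale, no localisation along stopping times of the raw filtration is needed.
Itô (1944); Revuz–Yor, *Continuous Martingales and Brownian Motion* (1999), Ch. IV, Thm (2.2)
and Prop. (2.8). [cite: RevuzYor1999, Ch. IV Thm (2.2)] -/
theorem exists_isItoIntegral_of_sq_integrable {H : ℝ≥0 → (ℝ≥0 → ℝ) → ℝ}
    (hH : IsStronglyProgressive RandomPlanarGeometry.brownianFiltration H)
    (hfin : ∀ t : ℝ≥0, ∫⁻ ω, (∫⁻ s in Set.Icc (0 : ℝ) t, ENNReal.ofReal (H s.toNNReal ω ^ 2))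
      ∂preWienerMeasure ≠ ∞) :
    ∃ J : ℝ≥0 → (ℝ≥0 → ℝ) → ℝ, IsItoIntegral H brownian J RandomPlanarGeometry.brownianFiltration preWienerMeasure ∧
      Martingale J RandomPlanarGeometry.brownianFiltration preWienerMeasure ∧ ∀ t, MemLp (J t) 2 preWienerMeasure := by
  haveI := RandomPlanarGeometry.isProbabilityMeasure_preWienerMeasure'
  have hfin' : ∀ t : ℝ≥0, sqErr H 0 preWienerMeasure t ≠ ∞ := fun t ↦ by
    simpa [sqErr] using hfin t
  obtain ⟨J, hJ, hJM, hJ2, -⟩ := exists_isItoIntegral_of_sqErr_ne_top RandomPlanarGeometry.martingale_brownian_holds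
    RandomPlanarGeometry.martingale_brownian_sq_sub_holds RandomPlanarGeometry.memLp_two_brownian continuous_brownian hH hfin'
  exact ⟨J, hJ, hJM, hJ2⟩

end Existence

end Literature.Probability.Process
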